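import Literature.NumberTheory.Connes2026.SemilocalCutoffConjugation
import Literature.NumberTheory.Connes2026.ArchimedeanCutoffTraceAsymptotics
import Literature.NumberTheory.ConnesConsani2024.SemilocalSoninSpaceGeneralS
import HarnessLib

/-!
# Connes 1999 Thm VII.4, `k = ℚ`, `S = {∞} ∪ P` — REDUCTION OF THE SEMILOCAL TRACE FORMULA TO THE
# ANNULUS CORRECTION: `Connes1999_thm_VII_4_rat` at `P` follows from the archimedean theorem (PROVED,
# `Connes1999_thm_VII_4_rat_archimedean`) and the trace asymptotics of `ϑ(g) P̂⁰_Λ (u_S^* P_Λ u_S − P_Λ)`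

LABEL (line 1): RH-FREE literature (theorems + two definitions with bodies; NO named fact; the one theorem
with hypotheses is a DOOR: its two hypotheses are the explicit analytic statements about the annulus
correction that remain to be proved, spelled out in the tree's vocabulary — they are binders, not new facts).
bears_on: LADDER-RH W-C/W-P (C1 named-fact debt), cell `rh-crit`, sub-cell cc, overflow row O1 — green layer
under the row's last named fact `Connes1999_thm_VII_4_rat` (the cases `P ≠ ∅`), third file of the
"annulus road" (`SemilocalCutoffConjugation.lean`, `AnnulusScalingSupport.lean`).  WHAT THIS IS NOT: any claim
about positivity, Weil's criterion or RH — a bookkeeping reduction between cutoff-trace statements; nothing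
here bears on the truth of RH.

Sources.  A. Connes, Selecta Math. 5 (1999) [`Connes1999`], §VII (12)–(13), Thm VII.4 and its proof
(30)–(32): "`log|u| = Σ_{v∈S} log|u_v|`" — the trace splits as the archimedean term plus one local term per
finite place (held text `paper:arxiv-math_9811068`, p0013); Connes 2026 Letter [`Connes2026Letter`] §7.4
display; A. Connes, C. Consani, H. Moscovici, Ann. Funct. Anal. 15 (2024) [`ConnesConsaniMoscovici2024`]
§4.2, §4.7 (the pulled-back `θ_S`, `η_S`, `𝔽_S`).

## What is proved

Write `u_S = twistUnitary P = θ_S η_S` (first file), `P_Λ = cutoffProj Λ` (Connes 2026 namespace),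
`P̂⁰_Λ = dualCutoffProj ∅ Λ = 𝓕 P_Λ 𝓕⁻¹`, `K_S(Λ) := u_S^* P_Λ u_S − P_Λ` (the annulus correction; for `P = {p}`
it is `u_p^* T Q₀ η_p + Q₀ D_p η_p`, `Q₀ = P_Λ − P_{Λ/p}`, by `adjoint_twistUnitary_mul_cutoffProj_mul_twistUnitary`).

* §1 `u_S` and `u_S^*` preserve the even subspace `L²(ℝ)_ev` (`twistUnitary_mem_evenPart`,
  `adjoint_twistUnitary_mem_evenPart`; dilations preserve parity, `lpDilation_mem_evenPart`), so `u_S^*`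
  restricts to a unitary of `evenPart` (`twistUnitaryEven P : evenPart ≃ₗᵢ[ℂ] evenPart`, the restriction of
  `u_S`, with inverse the restriction of `u_S^*`) and transports Hilbert bases:
  `HilbertBasis.twistConj P b`, with `(b.twistConj P i : L²) = u_S^* (b i)` (`HilbertBasis.coe_twistConj`).
* §2 `diagCoeff` is additive in the operator (`diagCoeff_add`, `diagCoeff_sub`).
* §3 **The door** `Connes1999_thm_VII_4_rat_at_of_annulusCorrection`: fix a finite set of primes `P` and a
  Weil test function `g`.  IF along every Hilbert basis `(f_i)` of `evenPart` the diagonal series of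
  `ϑ(g) P̂⁰_Λ K_S(Λ)` is summable for every `Λ > 0` and its sum tends to `Σ_{p∈P} connesLocalTerm p g` as
  `Λ → ∞`, THEN the conclusion of `Connes1999_thm_VII_4_rat` holds at `P` for `g` and every Hilbert basis
  `(e_i)`: by `diagCoeff_cutoffR_eq` the diagonal series of `ϑ(g) R_Λ^S` along `(e_i)` is that of
  `ϑ(g) P̂⁰_Λ P_Λ + ϑ(g) P̂⁰_Λ K_S(Λ)` along `(u_S^* e_i)`, and the first summand is the PROVED archimedean
  theorem `Connes1999_thm_VII_4_rat_archimedean` (seat gm-t13 g4) along that basis.  Corollary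
  `Connes1999_thm_VII_4_rat_of_annulusCorrection`: the named fact itself follows from the two annulus
  statements for all `P`.

No instance, notation or attribute; every definition has a body; no `def … : Prop`.
-/

noncomputable section

open _root_.MeasureTheory Complex Set Filter
open scoped Real Topology ComplexConjugate ENNReal InnerProductSpace

namespace Literature.NumberTheory.Connes2026

open Literature.NumberTheory.LFunctions Literature.Analysis.OperatorTheory
open Literature.NumberTheory.ConnesConsani
open Literature.NumberTheory.ConnesConsani2024
open Literature.NumberTheory.ConnesConsani2021 hiding cutoffProj cutoffProj_coeFn

/-! ## §1. `u_S`, `u_S^*` preserve `L²(ℝ)_ev`; transport of Hilbert bases -/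

section Even

/-- **Dilations preserve parity**: `D_a` maps a.e.-even functions to a.e.-even functions. [cite: ConnesConsaniMoscovici2024, §4.6 Def. 4.5 p. 21 (`L²(ℝ)^{ev}`, arXiv chunk p0014:L72)] -/
theorem lpDilation_mem_evenPart {a : ℝ} (ha : a ≠ 0) {ξ : Lp ℂ 2 (volume : Measure ℝ)} (hξ : ξ ∈ evenPart) :
    lpDilation (V := ℝ) (F := ℂ) (p := (2 : ℝ≥0∞)) a ha ENNReal.ofNat_ne_top ξ ∈ evenPart := by
  rw [mem_evenPart_iff] at hξ ⊢
  have h1 := lpDilation_coeFn (V := ℝ) (F := ℂ) (p := (2 : ℝ≥0∞)) ha ENNReal.ofNat_ne_top ξ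
  have h2 := ae_eq_comp_smul (V := ℝ) hξ ha
  have h3 : (fun x : ℝ => (lpDilation (V := ℝ) (F := ℂ) (p := (2 : ℝ≥0∞)) a ha ENNReal.ofNat_ne_top ξ : ℝ → ℂ) (-x))
      =ᵐ[volume] fun x => (ξ : ℝ → ℂ) (a • (-x)) :=
    (Measure.measurePreserving_neg (volume : Measure ℝ)).quasiMeasurePreserving.ae_eq_comp h1
  filter_upwards [h1, h2, h3] with x e1 e2 e3
  rw [e3, e1]
  simp only [smul_eq_mul, mul_neg] at e2 ⊢
  exact e2

/-- `D_p` preserves `L²(ℝ)_ev`. [cite: ConnesConsaniMoscovici2024, §4.2 eq. (44) p. 16 (arXiv chunk p0012:L74)] -/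
theorem primeDilation_mem_evenPart (q : ℕ) [Fact q.Prime] {ξ : Lp ℂ 2 (volume : Measure ℝ)} (hξ : ξ ∈ evenPart) :
    primeDilation q ξ ∈ evenPart := by
  rw [primeDilation_eq_lpDilation]
  exact lpDilation_mem_evenPart _ hξ

/-- `η_p⁻¹ = 1 − D_p` (`etaInvAt`) preserves `L²(ℝ)_ev`. [cite: ConnesConsaniMoscovici2024, §4.2 eq. (44) p. 16 (arXiv chunk p0012:L74)] -/
theorem etaInvAt_mem_evenPart (n : ℕ) {ξ : Lp ℂ 2 (volume : Measure ℝ)} (hξ : ξ ∈ evenPart) :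
    etaInvAt n ξ ∈ evenPart := by
  by_cases hn : n.Prime
  · haveI : Fact n.Prime := ⟨hn⟩
    rw [etaInvAt_of_prime, sub_apply, one_apply_eq_self]
    exact Submodule.sub_mem _ hξ (primeDilation_mem_evenPart n hξ)
  · rw [etaInvAt_of_not_prime hn, one_apply_eq_self]; exact hξ

/-- `η_p` (`etaAt`) preserves `L²(ℝ)_ev` (Neumann series in `D_p`, `evenPart` closed). [cite: ConnesConsaniMoscovici2024, §4.2 eqs. (44)–(46) pp. 16–17 (arXiv chunk p0012:L74–L94)] -/
theorem etaAt_mem_evenPart (n : ℕ) {ξ : Lp ℂ 2 (volume : Measure ℝ)} (hξ : ξ ∈ evenPart) :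
    etaAt n ξ ∈ evenPart := by
  by_cases hn : n.Prime
  · haveI : Fact n.Prime := ⟨hn⟩
    rw [etaAt_of_prime]
    exact semilocalEta_mem_of_mem n isClosed_evenPart (fun ζ hζ => primeDilation_mem_evenPart n hζ) hξ
  · rw [etaAt_of_not_prime hn, one_apply_eq_self]; exact hξ

/-- A product of operators each preserving a submodule preserves it. [folklore] -/
private theorem list_prod_mem_of_mem {V : Submodule ℂ (Lp ℂ 2 (volume : Measure ℝ))}
    (l : List (Lp ℂ 2 (volume : Measure ℝ) →L[ℂ] Lp ℂ 2 (volume : Measure ℝ)))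
    (hl : ∀ A ∈ l, ∀ ξ ∈ V, A ξ ∈ V) {ξ : Lp ℂ 2 (volume : Measure ℝ)} (hξ : ξ ∈ V) : l.prod ξ ∈ V := by
  induction l with
  | nil => simpa using hξ
  | cons A l ih =>
    rw [List.prod_cons, mul_apply_eq_comp]
    exact hl A (by simp) _ (ih (fun B hB => hl B (by simp [hB])))

/-- `η_S` preserves `L²(ℝ)_ev`. [cite: ConnesConsaniMoscovici2024, §4.2 eq. (44) p. 16 (arXiv chunk p0012:L74)] -/
theorem etaProd_mem_evenPart (P : Finset ℕ) {ξ : Lp ℂ 2 (volume : Measure ℝ)} (hξ : ξ ∈ evenPart) :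
    etaProd P ξ ∈ evenPart :=
  list_prod_mem_of_mem _ (fun A hA ζ hζ => by
    obtain ⟨n, -, rfl⟩ := List.mem_map.mp hA
    exact etaAt_mem_evenPart n hζ) hξ

/-- `η_S⁻¹` preserves `L²(ℝ)_ev`. [cite: ConnesConsaniMoscovici2024, §4.2 eq. (44) p. 16 (arXiv chunk p0012:L74)] -/
theorem etaInvProd_mem_evenPart (P : Finset ℕ) {ξ : Lp ℂ 2 (volume : Measure ℝ)} (hξ : ξ ∈ evenPart) :
    etaInvProd P ξ ∈ evenPart :=
  list_prod_mem_of_mem _ (fun A hA ζ hζ => by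
    obtain ⟨n, -, rfl⟩ := List.mem_map.mp hA
    exact etaInvAt_mem_evenPart n hζ) hξ

/-- **`u_S` preserves `L²(ℝ)_ev`.** [cite: ConnesConsaniMoscovici2024, Prop. 4.2 (ii) §4.2 p. 18 (operators of `L²(X_S)^{K_S} ≅ L²(ℝ)^{ev}`)] -/
theorem twistUnitary_mem_evenPart (P : Finset ℕ) {ξ : Lp ℂ 2 (volume : Measure ℝ)} (hξ : ξ ∈ evenPart) :
    twistUnitary P ξ ∈ evenPart := by
  rw [twistUnitary_def, mul_apply_eq_comp]
  exact twistProd_mem_evenPart P (etaProd_mem_evenPart P hξ)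

/-- **`u_S^*` preserves `L²(ℝ)_ev`.** [cite: ConnesConsaniMoscovici2024, Prop. 4.2 (ii) §4.2 p. 18] -/
theorem adjoint_twistUnitary_mem_evenPart (P : Finset ℕ) {ξ : Lp ℂ 2 (volume : Measure ℝ)} (hξ : ξ ∈ evenPart) :
    ContinuousLinearMap.adjoint (twistUnitary P) ξ ∈ evenPart := by
  rw [adjoint_twistUnitary, mul_apply_eq_comp, coe_twistProdUnit_inv]
  exact twistInvProd_mem_evenPart P (etaInvProd_mem_evenPart P hξ)

/-- **The restriction of `u_S` to `L²(ℝ)_ev` as a unitary of `evenPart`** (inverse: the restriction of `u_S^*`). [cite: ConnesConsaniMoscovici2024, Prop. 4.2 (ii) §4.2 p. 18] -/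
def twistUnitaryEven (P : Finset ℕ) : evenPart ≃ₗᵢ[ℂ] (evenPart : Submodule ℂ (Lp ℂ 2 (volume : Measure ℝ))) where
  toFun x := ⟨twistUnitary P x, twistUnitary_mem_evenPart P x.2⟩
  invFun x := ⟨ContinuousLinearMap.adjoint (twistUnitary P) x, adjoint_twistUnitary_mem_evenPart P x.2⟩
  map_add' x y := by ext1; simp
  map_smul' c x := by ext1; simp
  left_inv x := by
    ext1
    change (ContinuousLinearMap.adjoint (twistUnitary P) * twistUnitary P) (x : Lp ℂ 2 (volume : Measure ℝ)) = x
    rw [adjoint_twistUnitary_mul_self, one_apply_eq_self]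
  right_inv x := by
    ext1
    change (twistUnitary P * ContinuousLinearMap.adjoint (twistUnitary P)) (x : Lp ℂ 2 (volume : Measure ℝ)) = x
    rw [twistUnitary_mul_adjoint_self, one_apply_eq_self]
  norm_map' x := by
    change ‖twistUnitary P (x : Lp ℂ 2 (volume : Measure ℝ))‖ = ‖(x : Lp ℂ 2 (volume : Measure ℝ))‖
    rw [norm_eq_sqrt_re_inner (𝕜 := ℂ), norm_eq_sqrt_re_inner (𝕜 := ℂ), inner_twistUnitary_twistUnitary]

/-- The restriction acts as `u_S`. [cite: ConnesConsaniMoscovici2024, Prop. 4.2 (ii) §4.2 p. 18] -/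
theorem coe_twistUnitaryEven (P : Finset ℕ) (x : evenPart) :
    ((twistUnitaryEven P x : evenPart) : Lp ℂ 2 (volume : Measure ℝ)) = twistUnitary P x := rfl

/-- Its inverse acts as `u_S^*`. [cite: ConnesConsaniMoscovici2024, Prop. 4.2 (ii) §4.2 p. 18] -/
theorem coe_twistUnitaryEven_symm (P : Finset ℕ) (x : evenPart) :
    (((twistUnitaryEven P).symm x : evenPart) : Lp ℂ 2 (volume : Measure ℝ)) =
      ContinuousLinearMap.adjoint (twistUnitary P) x := rfl

/-- **Transport of a Hilbert basis of `L²(ℝ)_ev` by `u_S^*`**: `(b.twistConj P) i = u_S^* (b i)`. [cite: Connes1999, §VII Thm 4 (arXiv p0013:L1) (the trace along any orthonormal basis)] -/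
def _root_.HilbertBasis.twistConj {ι : Type*} (b : HilbertBasis ι ℂ (evenPart : Submodule ℂ (Lp ℂ 2 (volume : Measure ℝ))))
    (P : Finset ℕ) : HilbertBasis ι ℂ (evenPart : Submodule ℂ (Lp ℂ 2 (volume : Measure ℝ))) :=
  ⟨(twistUnitaryEven P).trans b.repr⟩

/-- The transported basis vectors are `u_S^* b_i`. [cite: Connes1999, §VII Thm 4 (arXiv p0013:L1)] -/
theorem _root_.HilbertBasis.coe_twistConj {ι : Type*}
    (b : HilbertBasis ι ℂ (evenPart : Submodule ℂ (Lp ℂ 2 (volume : Measure ℝ)))) (P : Finset ℕ) (i : ι) :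
    ((b.twistConj P i : evenPart) : Lp ℂ 2 (volume : Measure ℝ)) =
      ContinuousLinearMap.adjoint (twistUnitary P) ((b i : evenPart) : Lp ℂ 2 (volume : Measure ℝ)) := by
  classical
  rw [← b.repr_symm_single i, ← (b.twistConj P).repr_symm_single i]
  rfl

end Even

/-! ## §2. Additivity of the diagonal coefficient in the operator -/

section DiagCoeff

/-- `⟪e, ϑ(g)(A + B)e⟫ = ⟪e, ϑ(g)Ae⟫ + ⟪e, ϑ(g)Be⟫`. [cite: Connes1999, §VII Thm 4 (arXiv p0013:L1)] -/
theorem diagCoeff_add (g : ℝ → ℂ) (A B : Lp ℂ 2 (volume : Measure ℝ) →L[ℂ] Lp ℂ 2 (volume : Measure ℝ))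
    (e : Lp ℂ 2 (volume : Measure ℝ)) : diagCoeff g (A + B) e = diagCoeff g A e + diagCoeff g B e := by
  simp only [diagCoeff, add_apply, map_add, inner_add_right]

/-- `⟪e, ϑ(g)(A − B)e⟫ = ⟪e, ϑ(g)Ae⟫ − ⟪e, ϑ(g)Be⟫`. [cite: Connes1999, §VII Thm 4 (arXiv p0013:L1)] -/
theorem diagCoeff_sub (g : ℝ → ℂ) (A B : Lp ℂ 2 (volume : Measure ℝ) →L[ℂ] Lp ℂ 2 (volume : Measure ℝ))
    (e : Lp ℂ 2 (volume : Measure ℝ)) : diagCoeff g (A - B) e = diagCoeff g A e - diagCoeff g B e := by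
  simp only [diagCoeff, sub_apply, map_sub, inner_sub_right]

/-- Left distributivity used below: `P̂⁰ (u^* P u) = P̂⁰ P + P̂⁰ (u^* P u − P)`. [folklore] -/
private theorem mul_eq_mul_add_mul_sub (X Y Z : Lp ℂ 2 (volume : Measure ℝ) →L[ℂ] Lp ℂ 2 (volume : Measure ℝ)) :
    X * Y = X * Z + X * (Y - Z) := by
  rw [mul_sub, add_sub_cancel]

end DiagCoeff

/-! ## §3. The door: the fact at `P` from the archimedean theorem and the annulus correction -/

section Door

/-- **Reduction of Connes 1999 Thm VII.4 (`k = ℚ`, `S = {∞} ∪ P`, `K_S`-invariant picture) to the annulus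
correction.**  For a finite set of primes `P` and a Weil test function `g`, suppose that along every Hilbert
basis `(f_i)` of `L²(ℝ)_ev` the diagonal series of `ϑ(g) P̂⁰_Λ (u_S^* P_Λ u_S − P_Λ)` is summable for every
`Λ > 0` (hypothesis `hsum`) and that its sum tends to `Σ_{p ∈ P} ∫′_{ℚ_p^*} h(u⁻¹)/|1−u|_p d^*u =
Σ_{p∈P} connesLocalTerm p g` as `Λ → ∞` (hypothesis `hlim`).  Then for every Hilbert basis `(e_i)` of
`L²(ℝ)_ev` the diagonal series of `ϑ(g) R_Λ^S` is summable for every `Λ > 0` and its sum is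
`connesSemilocalGeometricSide P Λ g + o(1)` — the conclusion of `Connes1999_thm_VII_4_rat` at `P`, `g`, `(e_i)`.
Proof: `R_Λ^S = u_S P̂⁰_Λ u_S^* P_Λ` and `⟪e_i, ϑ(g)R_Λ^S e_i⟫ = ⟪u_S^*e_i, ϑ(g)P̂⁰_Λ(u_S^*P_Λu_S)u_S^*e_i⟫`
(`diagCoeff_cutoffR_eq`), `u_S^* P_Λ u_S = P_Λ + K_S(Λ)`, and the `P_Λ` part along the Hilbert basis
`(u_S^* e_i)` is the PROVED archimedean theorem `Connes1999_thm_VII_4_rat_archimedean` (Connes 1999 Thm V.3).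
This is the `K_S`-invariant shadow of the printed step "`log|u| = Σ_{v∈S} log|u_v|`" (VII (30)–(32)).
[cite: Connes1999, §VII Thm 4 and its proof eqs. (30)–(32) (arXiv p0013); Connes2026Letter, §7.4 display (arXiv p0025:L16)] -/
theorem Connes1999_thm_VII_4_rat_at_of_annulusCorrection (P : Finset ℕ) {g : ℝ → ℂ} (hg : IsWeilTest g)
    (hsum : ∀ (ι : Type) (f : HilbertBasis ι ℂ (evenPart : Submodule ℂ (Lp ℂ 2 (volume : Measure ℝ)))),
      ∀ Λ : ℝ, 0 < Λ →
        Summable fun i => diagCoeff g (dualCutoffProj ∅ Λ *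
          (ContinuousLinearMap.adjoint (twistUnitary P) * cutoffProj Λ * twistUnitary P - cutoffProj Λ))
          ((f i : evenPart) : Lp ℂ 2 (volume : Measure ℝ)))
    (hlim : ∀ (ι : Type) (f : HilbertBasis ι ℂ (evenPart : Submodule ℂ (Lp ℂ 2 (volume : Measure ℝ)))),
      Tendsto (fun Λ : ℝ => ∑' i, diagCoeff g (dualCutoffProj ∅ Λ *
          (ContinuousLinearMap.adjoint (twistUnitary P) * cutoffProj Λ * twistUnitary P - cutoffProj Λ))
          ((f i : evenPart) : Lp ℂ 2 (volume : Measure ℝ)))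
        atTop (𝓝 (∑ p ∈ P, connesLocalTerm p g)))
    (ι : Type) (b : HilbertBasis ι ℂ (evenPart : Submodule ℂ (Lp ℂ 2 (volume : Measure ℝ)))) :
    (∀ Λ : ℝ, 0 < Λ →
      Summable fun i => diagCoeff g (cutoffR P Λ) ((b i : evenPart) : Lp ℂ 2 (volume : Measure ℝ))) ∧
    Tendsto (fun Λ : ℝ =>
        (∑' i, diagCoeff g (cutoffR P Λ) ((b i : evenPart) : Lp ℂ 2 (volume : Measure ℝ)))
          - connesSemilocalGeometricSide P Λ g)
      atTop (𝓝 0) := by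
  set f := b.twistConj P with hf
  set us := ContinuousLinearMap.adjoint (twistUnitary P) with hus
  set K : ℝ → (Lp ℂ 2 (volume : Measure ℝ) →L[ℂ] Lp ℂ 2 (volume : Measure ℝ)) :=
    fun Λ => us * cutoffProj Λ * twistUnitary P - cutoffProj Λ with hK
  -- the pointwise splitting of the diagonal coefficients
  have hsplit : ∀ Λ i, diagCoeff g (cutoffR P Λ) ((b i : evenPart) : Lp ℂ 2 (volume : Measure ℝ)) =
      diagCoeff g (fourierL2 * cutoffProj Λ * fourierL2Inv * cutoffProj Λ)
          ((f i : evenPart) : Lp ℂ 2 (volume : Measure ℝ)) +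
        diagCoeff g (dualCutoffProj ∅ Λ * K Λ) ((f i : evenPart) : Lp ℂ 2 (volume : Measure ℝ)) := by
    intro Λ i
    rw [diagCoeff_cutoffR_eq, hf, HilbertBasis.coe_twistConj, ← hus,
      mul_eq_mul_add_mul_sub (dualCutoffProj ∅ Λ) (us * cutoffProj Λ * twistUnitary P) (cutoffProj Λ),
      diagCoeff_add, dualCutoffProj_empty]
  have harch := Connes1999_thm_VII_4_rat_archimedean hg f
  refine ⟨fun Λ hΛ => ?_, ?_⟩
  · have h1 := harch.1 Λ hΛ
    have h2 := hsum ι f Λ hΛ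
    exact (h1.add h2).congr fun i => (hsplit Λ i).symm
  · have h1 := harch.2
    have h2 := hlim ι f
    have h3 := h1.add h2
    rw [zero_add] at h3
    have h4 : Tendsto (fun Λ : ℝ =>
        ((∑' i, diagCoeff g (fourierL2 * cutoffProj Λ * fourierL2Inv * cutoffProj Λ)
            ((f i : evenPart) : Lp ℂ 2 (volume : Measure ℝ)))
          - (2 * (Real.log Λ : ℂ) * g 0 + connesArchPV g))
        + (∑' i, diagCoeff g (dualCutoffProj ∅ Λ * K Λ) ((f i : evenPart) : Lp ℂ 2 (volume : Measure ℝ)))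
        - ∑ p ∈ P, connesLocalTerm p g) atTop (𝓝 0) := by
      have := h3.sub_const (∑ p ∈ P, connesLocalTerm p g)
      rwa [sub_self] at this
    refine (h4.congr' ?_)
    filter_upwards [eventually_gt_atTop (0 : ℝ)] with Λ hΛ
    have hs1 := harch.1 Λ hΛ
    have hs2 := hsum ι f Λ hΛ
    rw [show (∑' i, diagCoeff g (cutoffR P Λ) ((b i : evenPart) : Lp ℂ 2 (volume : Measure ℝ))) =
        (∑' i, diagCoeff g (fourierL2 * cutoffProj Λ * fourierL2Inv * cutoffProj Λ)
            ((f i : evenPart) : Lp ℂ 2 (volume : Measure ℝ))) +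
          ∑' i, diagCoeff g (dualCutoffProj ∅ Λ * K Λ) ((f i : evenPart) : Lp ℂ 2 (volume : Measure ℝ)) by
      rw [← hs1.tsum_add hs2]; exact tsum_congr (hsplit Λ), connesSemilocalGeometricSide]
    ring

/-- **The named fact from the annulus correction**: if for EVERY finite set of primes `P` and every Weil test
function the two annulus statements hold, then `Connes1999_thm_VII_4_rat` holds (its `P = ∅` content being
the proved archimedean theorem, the correction vanishing identically there: `u_∅ = 1`). [cite: Connes1999, §VII Thm 4 (arXiv p0013:L1)] -/
theorem Connes1999_thm_VII_4_rat_of_annulusCorrection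
    (H : ∀ (P : Finset ℕ), (∀ p ∈ P, p.Prime) → ∀ g : ℝ → ℂ, IsWeilTest g →
      (∀ (ι : Type) (f : HilbertBasis ι ℂ (evenPart : Submodule ℂ (Lp ℂ 2 (volume : Measure ℝ)))),
        ∀ Λ : ℝ, 0 < Λ →
          Summable fun i => diagCoeff g (dualCutoffProj ∅ Λ *
            (ContinuousLinearMap.adjoint (twistUnitary P) * cutoffProj Λ * twistUnitary P - cutoffProj Λ))
            ((f i : evenPart) : Lp ℂ 2 (volume : Measure ℝ))) ∧
      (∀ (ι : Type) (f : HilbertBasis ι ℂ (evenPart : Submodule ℂ (Lp ℂ 2 (volume : Measure ℝ)))),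
        Tendsto (fun Λ : ℝ => ∑' i, diagCoeff g (dualCutoffProj ∅ Λ *
            (ContinuousLinearMap.adjoint (twistUnitary P) * cutoffProj Λ * twistUnitary P - cutoffProj Λ))
            ((f i : evenPart) : Lp ℂ 2 (volume : Measure ℝ)))
          atTop (𝓝 (∑ p ∈ P, connesLocalTerm p g)))) :
    Connes1999_thm_VII_4_rat := by
  intro P hP g hg ι b
  obtain ⟨hsum, hlim⟩ := H P hP g hg
  exact Connes1999_thm_VII_4_rat_at_of_annulusCorrection P hg hsum hlim ι b

/-- **At `P = ∅` the annulus correction vanishes** (`u_∅ = 1`), so the door's hypotheses hold trivially there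
and the door reproduces the archimedean theorem. [cite: Connes1999, §V Thm 3 and §VII Thm 4 (arXiv p0013)] -/
theorem annulusCorrection_empty (Λ : ℝ) :
    ContinuousLinearMap.adjoint (twistUnitary ∅) * cutoffProj Λ * twistUnitary ∅ - cutoffProj Λ = 0 := by
  have hu : twistUnitary ∅ = 1 := by rw [twistUnitary_def, twistProd_empty, etaProd_empty, mul_one]
  rw [hu, ← ContinuousLinearMap.star_eq_adjoint, star_one, one_mul, mul_one, sub_self]

end Door

end Literature.NumberTheory.Connes2026
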